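import Summits.QuantumFields.YangMills.Theorems.LuscherReductionTwistedTraceScalingBTFarPairs
import Summits.QuantumFields.YangMills.Theorems.LuscherReductionTwistedTraceScalingBOStiffColour
import HarnessLib

/-!
# (B-ST) stub (L-1b): kinetic defect of FAR slow pairs against BASED gauge fields — the Polyakov line through the origin
# (lane A of S-BASE, crux `TwistedTraceScaling` stmt-QuantumFields-20203, C4-CORE, the (B-ST) pen; HANDOFF-g21 UPDATE 20:05Z)

The tree's far-pair bound `kinDefect_ge_far` pins the COLOUR MEAN of the gauge field; for the based average of the (B-ST) core its rough/smooth split needs a jump threshold above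
the slow amplitude `δ ~ β^{-s}` and then loses `Nδ²` against `Nα`, which fails for `s < 1/4`.  For BASED fields (`g_0 = 1`) there is an exact handle instead: the ordered product
of the links along the lattice line through the origin in direction `k` (a Polyakov line, sites `x_j = j·e_k`, `x_L = x_0 = 0`) is based-gauge INVARIANT, so its difference between
the two configurations bounds the line's kinetic defect from below whatever the based field does.  No new definitions: the line product is written as
`((List.range n).map fun j => q(W_{(x_j,k)})).prod`.
★ `norm_lineProd_sub_le` — telescoping `‖P_n(U)·q(g_{x_n}) − q(g_{x_0})·P_n(V)‖ ≤ Σ_{j<n} ‖q(U_{e_j})q(g_{x_{j+1}}) − q(g_{x_j})q(V_{e_j})‖` (unit quaternions);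
★ `norm_pow_sub_pow_ge` — `‖x^n − y^n‖ ≥ n(1 − (n−1)δ)‖x−y‖` for unit quaternions within `δ` of `1`;
★★★ `kinDefect_ge_based_far` — for tube points `U = orthoTube u v`, `V = orthoTube u' v'` and ANY based field `basedExt h`:
`kinDefect U V (basedExt h) ≥ m²/L`, `m = L(1 − (L−1)δ)·‖q(u_k) − q(u'_k)‖ − L√2(‖v̂‖ + ‖v̂'‖) ≥ 0` (`‖q(u_k) − 1‖, ‖q(u'_k) − 1‖ ≤ δ`).
With `transferKernel_gaugeTransform_le` this makes the based kernel of far slow pairs (`‖q(u_k) − q(u'_k)‖ ≥ α₀ ≫ β^{-1/2}`) superpolynomially small — the far half of the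
`τ` of `…BOStiffSlowAssembly.form_le_of_product_near` (near half: ✓ `…BOStiffTransportTail`).
HONEST FRAMING: bookkeeping for a stub of a child of the CONDITIONAL route R2b1; (B-ST) OPEN; C4-CORE OPEN; not infinite volume, not a gap, not Clay.
-/

set_option autoImplicit false

noncomputable section

open MeasureTheory
open scoped Quaternion

namespace Summit.QuantumFields.YangMills.Theorems.FemtoTransferGap.TwoLattice.ConstTube

open Literature.MathematicalPhysics.QuantumFieldTheory Literature.MathematicalPhysics.QuantumLattice TwoLattice.Avg
open Literature.MathematicalPhysics.QuantumFieldTheory.Balaban1983to89.T4HaarSU2Translate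

variable {L : ℕ} [NeZero L]

/-! ## §1 The line through the origin: sites `x_j = j • e_k` -/

omit [NeZero L] in
/-- `x_{j+1} = x_j.shift k`. [folklore] -/
theorem lineSite_succ (k : Fin 3) (j : ℕ) : ((j + 1) • Pi.single k (1 : ZMod L) : Site 3 L) = (j • Pi.single k (1 : ZMod L) : Site 3 L).shift k := by
  simp only [Site.shift, succ_nsmul]

omit [NeZero L] in
/-- `x_L = 0` (the line closes up on the torus). [folklore] -/
theorem lineSite_L (k : Fin 3) : (L • Pi.single k (1 : ZMod L) : Site 3 L) = 0 := by
  funext i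
  simp only [Pi.smul_apply, nsmul_eq_mul, Pi.zero_apply, ZMod.natCast_self, zero_mul]

omit [NeZero L] in
/-- The sites `x_j`, `j < L`, are distinct. [folklore] -/
theorem lineSite_injOn (k : Fin 3) : Set.InjOn (fun j : ℕ => (j • Pi.single k (1 : ZMod L) : Site 3 L)) (Finset.range L : Set ℕ) := by
  intro j hj j' hj' h
  have hjL : j < L := by simpa using hj
  have hj'L : j' < L := by simpa using hj'
  have h1 := congr_fun h k
  simp only [Pi.smul_apply, Pi.single_eq_same, nsmul_eq_mul, mul_one] at h1
  have h2 := (ZMod.natCast_eq_natCast_iff' j j' L).1 h1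
  rwa [Nat.mod_eq_of_lt hjL, Nat.mod_eq_of_lt hj'L] at h2

omit [NeZero L] in
/-- `‖P_n(W)‖ = 1` for the ordered line product `P_n(W) = q(W_{e_0}) ⋯ q(W_{e_{n−1}})`. [folklore] -/
theorem norm_lineProd (W : GaugeConfig 3 L SU2) (k : Fin 3) : ∀ n : ℕ,
    ‖((List.range n).map fun j : ℕ => su2Quat (W ((j • Pi.single k (1 : ZMod L) : Site 3 L), k))).prod‖ = 1
  | 0 => by simp
  | n + 1 => by rw [List.prod_range_succ, norm_mul, norm_lineProd W k n, norm_su2Quat, one_mul]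

omit [NeZero L] in
/-- ★ **Telescoping along the line against a gauge field**:
`‖P_n(U)·q(g_{x_n}) − q(g_{x_0})·P_n(V)‖ ≤ Σ_{j<n} ‖q(U_{e_j})·q(g_{x_{j+1}}) − q(g_{x_j})·q(V_{e_j})‖`. [folklore] -/
theorem norm_lineProd_sub_le (U V : GaugeConfig 3 L SU2) (g : Site 3 L → SU2) (k : Fin 3) : ∀ n : ℕ,
    ‖((List.range n).map fun j : ℕ => su2Quat (U ((j • Pi.single k (1 : ZMod L) : Site 3 L), k))).prod * su2Quat (g (n • Pi.single k (1 : ZMod L))) -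
        su2Quat (g ((0 : ℕ) • Pi.single k (1 : ZMod L))) * ((List.range n).map fun j : ℕ => su2Quat (V ((j • Pi.single k (1 : ZMod L) : Site 3 L), k))).prod‖ ≤
      ∑ j ∈ Finset.range n, ‖su2Quat (U ((j • Pi.single k (1 : ZMod L) : Site 3 L), k)) * su2Quat (g ((j • Pi.single k (1 : ZMod L) : Site 3 L).shift k)) -
        su2Quat (g (j • Pi.single k (1 : ZMod L))) * su2Quat (V ((j • Pi.single k (1 : ZMod L) : Site 3 L), k))‖
  | 0 => by simp
  | n + 1 => by
    rw [Finset.sum_range_succ, ← lineSite_succ, List.prod_range_succ, List.prod_range_succ]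
    have ih := norm_lineProd_sub_le U V g k n
    set Pu := ((List.range n).map fun j : ℕ => su2Quat (U ((j • Pi.single k (1 : ZMod L) : Site 3 L), k))).prod
    set Pv := ((List.range n).map fun j : ℕ => su2Quat (V ((j • Pi.single k (1 : ZMod L) : Site 3 L), k))).prod
    set a := su2Quat (U ((n • Pi.single k (1 : ZMod L) : Site 3 L), k))
    set b := su2Quat (V ((n • Pi.single k (1 : ZMod L) : Site 3 L), k))
    set g0 := su2Quat (g ((0 : ℕ) • Pi.single k (1 : ZMod L)))
    set gn := su2Quat (g (n • Pi.single k (1 : ZMod L)))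
    set gn1 := su2Quat (g ((n + 1) • Pi.single k (1 : ZMod L)))
    have e : Pu * a * gn1 - g0 * (Pv * b) = Pu * (a * gn1 - gn * b) + (Pu * gn - g0 * Pv) * b := by noncomm_ring
    rw [e]
    refine (norm_add_le _ _).trans ?_
    rw [norm_mul, norm_mul, norm_lineProd U k n, one_mul, norm_su2Quat, mul_one]
    linarith

omit [NeZero L] in
/-- ★ **Based fields see the closed line**: for `g = basedExt h` (`g_0 = 1`) and `n = L` (`x_L = x_0 = 0`),
`‖P_L(U) − P_L(V)‖ ≤ Σ_{j<L} ‖q(U_{e_j})q(g_{x_{j+1}}) − q(g_{x_j})q(V_{e_j})‖`. [folklore] -/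
theorem norm_lineProd_sub_le_based (U V : GaugeConfig 3 L SU2) (h : NzSite L → SU2) (k : Fin 3) :
    ‖((List.range L).map fun j : ℕ => su2Quat (U ((j • Pi.single k (1 : ZMod L) : Site 3 L), k))).prod -
        ((List.range L).map fun j : ℕ => su2Quat (V ((j • Pi.single k (1 : ZMod L) : Site 3 L), k))).prod‖ ≤
      ∑ j ∈ Finset.range L, ‖su2Quat (U ((j • Pi.single k (1 : ZMod L) : Site 3 L), k)) * su2Quat (basedExt L h ((j • Pi.single k (1 : ZMod L) : Site 3 L).shift k)) -
        su2Quat (basedExt L h (j • Pi.single k (1 : ZMod L))) * su2Quat (V ((j • Pi.single k (1 : ZMod L) : Site 3 L), k))‖ := by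
  have h1 := norm_lineProd_sub_le U V (basedExt L h) k L
  rwa [lineSite_L, zero_nsmul, basedExt_zero, su2Quat_one, mul_one, one_mul] at h1

/-- The line's share of the kinetic defect: `Σ_{j<L} ‖D_{e_j}‖² ≤ kinDefect U V g`. [folklore] -/
theorem sum_line_sq_le_kinDefect (U V : GaugeConfig 3 L SU2) (g : Site 3 L → SU2) (k : Fin 3) :
    ∑ j ∈ Finset.range L, ‖su2Quat (U ((j • Pi.single k (1 : ZMod L) : Site 3 L), k)) * su2Quat (g ((j • Pi.single k (1 : ZMod L) : Site 3 L).shift k)) -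
        su2Quat (g (j • Pi.single k (1 : ZMod L))) * su2Quat (V ((j • Pi.single k (1 : ZMod L) : Site 3 L), k))‖ ^ 2 ≤
      kinDefect L U V g := by
  unfold kinDefect
  have hinj : Set.InjOn (fun j : ℕ => ((j • Pi.single k (1 : ZMod L) : Site 3 L), k)) (Finset.range L : Set ℕ) :=
    fun j hj j' hj' h => lineSite_injOn k hj hj' (congrArg Prod.fst h)
  rw [← Finset.sum_image (f := fun e : Edge 3 L => ‖su2Quat (U e) * su2Quat (g (e.1.shift e.2)) - su2Quat (g e.1) * su2Quat (V e)‖ ^ 2) hinj]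
  exact Finset.sum_le_sum_of_subset_of_nonneg (Finset.subset_univ _) fun e _ _ => sq_nonneg _

/-- ★ Hence `‖P_L(U) − P_L(V)‖² ≤ L · kinDefect U V (basedExt h)` (Cauchy–Schwarz on the line). [folklore] -/
theorem sq_norm_lineProd_sub_le_kinDefect (U V : GaugeConfig 3 L SU2) (h : NzSite L → SU2) (k : Fin 3) :
    ‖((List.range L).map fun j : ℕ => su2Quat (U ((j • Pi.single k (1 : ZMod L) : Site 3 L), k))).prod -
        ((List.range L).map fun j : ℕ => su2Quat (V ((j • Pi.single k (1 : ZMod L) : Site 3 L), k))).prod‖ ^ 2 ≤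
      L * kinDefect L U V (basedExt L h) := by
  have h1 := norm_lineProd_sub_le_based U V h k
  have h2 := sum_line_sq_le_kinDefect U V (basedExt L h) k
  have hCS := Finset.sum_mul_sq_le_sq_mul_sq (Finset.range L)
    (fun j : ℕ => ‖su2Quat (U ((j • Pi.single k (1 : ZMod L) : Site 3 L), k)) * su2Quat (basedExt L h ((j • Pi.single k (1 : ZMod L) : Site 3 L).shift k)) -
        su2Quat (basedExt L h (j • Pi.single k (1 : ZMod L))) * su2Quat (V ((j • Pi.single k (1 : ZMod L) : Site 3 L), k))‖)
    (fun _ => (1 : ℝ))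
  simp only [mul_one, one_pow, Finset.sum_const, Finset.card_range, Nat.smul_one_eq_cast] at hCS
  have h0 := norm_nonneg (((List.range L).map fun j : ℕ => su2Quat (U ((j • Pi.single k (1 : ZMod L) : Site 3 L), k))).prod -
        ((List.range L).map fun j : ℕ => su2Quat (V ((j • Pi.single k (1 : ZMod L) : Site 3 L), k))).prod)
  have h3 := pow_le_pow_left₀ h0 h1 2
  have hL0 : (0 : ℝ) ≤ L := Nat.cast_nonneg _
  nlinarith [h3, hCS, mul_le_mul_of_nonneg_right h2 hL0]

/-! ## §2 The line product of a tube point is close to the slow power -/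

/-- `‖P_n(orthoTube u v) − q(u_k)^n‖ ≤ n·√2·‖v̂‖`. [folklore] -/
theorem norm_lineProd_orthoTube_sub_pow_le (u : GaugeConfig 3 1 SU2) {v : Edge 3 L → Fin 3 → ℝ} (hv : v ∈ capBalancedSet L) (k : Fin 3) : ∀ n : ℕ,
    ‖((List.range n).map fun j : ℕ => su2Quat (orthoTube L u v ((j • Pi.single k (1 : ZMod L) : Site 3 L), k))).prod - su2Quat (u (0, k)) ^ n‖ ≤
      n * (Real.sqrt 2 * ‖linkEmbed L v‖)
  | 0 => by simp
  | n + 1 => by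
    have ih := norm_lineProd_orthoTube_sub_pow_le u hv k n
    have hv1 : ∀ e : Edge 3 L, ∑ a, v e a ^ 2 ≤ 1 := sum_sq_le_one_of_cap L hv.2
    have hlink := norm_su2Quat_orthoTube_sub_le (L := L) u hv1 ((n • Pi.single k (1 : ZMod L) : Site 3 L), k)
    rw [List.prod_range_succ]
    set P := ((List.range n).map fun j : ℕ => su2Quat (orthoTube L u v ((j • Pi.single k (1 : ZMod L) : Site 3 L), k))).prod
    set a := su2Quat (orthoTube L u v ((n • Pi.single k (1 : ZMod L) : Site 3 L), k))
    set x := su2Quat (u (0, k))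
    have hx : ‖x‖ = 1 := norm_su2Quat _
    have hP : ‖P‖ = 1 := norm_lineProd (orthoTube L u v) k n
    have e : P * a - x ^ (n + 1) = P * (a - x) + (P - x ^ n) * x := by rw [pow_succ]; noncomm_ring
    rw [e]
    refine (norm_add_le _ _).trans ?_
    rw [norm_mul, norm_mul, hP, one_mul, hx, mul_one, Nat.cast_succ]
    linarith

/-! ## §3 Powers of nearby unit quaternions separate linearly -/

/-- `‖x^n − 1‖ ≤ n‖x − 1‖` for `‖x‖ = 1`. [folklore] -/
theorem norm_pow_sub_one_le {x : ℍ} (hx : ‖x‖ = 1) : ∀ n : ℕ, ‖x ^ n - 1‖ ≤ n * ‖x - 1‖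
  | 0 => by simp
  | n + 1 => by
    have ih := norm_pow_sub_one_le hx n
    have e : x ^ (n + 1) - 1 = (x ^ n - 1) * x + (x - 1) := by rw [pow_succ]; noncomm_ring
    rw [e, Nat.cast_succ]
    refine (norm_add_le _ _).trans ?_
    rw [norm_mul, hx, mul_one]
    linarith

/-- ★ **Linear separation of powers**: `‖x^n − y^n − n(x − y)‖ ≤ n(n−1)δ‖x − y‖` for unit quaternions with `‖x − 1‖, ‖y − 1‖ ≤ δ`. [folklore] -/
theorem norm_pow_sub_pow_sub_le {x y : ℍ} (hx : ‖x‖ = 1) (hy : ‖y‖ = 1) {δ : ℝ} (hxδ : ‖x - 1‖ ≤ δ) (hyδ : ‖y - 1‖ ≤ δ) : ∀ n : ℕ,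
    ‖x ^ n - y ^ n - n • (x - y)‖ ≤ n * (n - 1) * δ * ‖x - y‖
  | 0 => by simp
  | n + 1 => by
    have ih := norm_pow_sub_pow_sub_le hx hy hxδ hyδ n
    have hδ0 : 0 ≤ δ := (norm_nonneg _).trans hxδ
    have hxn := norm_pow_sub_one_le hx n
    have e : x ^ (n + 1) - y ^ (n + 1) - (n + 1) • (x - y) =
        (x ^ n - 1) * (x - y) + (x ^ n - y ^ n - n • (x - y)) * y + n • ((x - y) * (y - 1)) := by
      simp only [nsmul_eq_mul, Nat.cast_succ, pow_succ]
      noncomm_ring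
    rw [e]
    have h0 := norm_add_le ((x ^ n - 1) * (x - y) + (x ^ n - y ^ n - n • (x - y)) * y) (n • ((x - y) * (y - 1)))
    have h0' := norm_add_le ((x ^ n - 1) * (x - y)) ((x ^ n - y ^ n - n • (x - y)) * y)
    have h1 : ‖(x ^ n - 1) * (x - y)‖ ≤ n * δ * ‖x - y‖ := by
      rw [norm_mul]; exact mul_le_mul_of_nonneg_right (hxn.trans (mul_le_mul_of_nonneg_left hxδ (Nat.cast_nonneg _))) (norm_nonneg _)
    have h2 : ‖(x ^ n - y ^ n - n • (x - y)) * y‖ ≤ n * (n - 1) * δ * ‖x - y‖ := by rw [norm_mul, hy, mul_one]; exact ih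
    have h3 : ‖n • ((x - y) * (y - 1))‖ ≤ n * (‖x - y‖ * δ) := by
      refine norm_nsmul_le.trans (mul_le_mul_of_nonneg_left ?_ (Nat.cast_nonneg _))
      rw [norm_mul]; exact mul_le_mul_of_nonneg_left hyδ (norm_nonneg _)
    have h4 : ((n + 1 : ℕ) : ℝ) = n + 1 := by push_cast; ring
    rw [h4]
    nlinarith [norm_nonneg (x - y), h0, h0', h1, h2, h3, hδ0]

/-- ★ Hence `‖x^n − y^n‖ ≥ n(1 − (n−1)δ)‖x − y‖`. [folklore] -/
theorem norm_pow_sub_pow_ge {x y : ℍ} (hx : ‖x‖ = 1) (hy : ‖y‖ = 1) {δ : ℝ} (hxδ : ‖x - 1‖ ≤ δ) (hyδ : ‖y - 1‖ ≤ δ) (n : ℕ) :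
    n * (1 - (n - 1) * δ) * ‖x - y‖ ≤ ‖x ^ n - y ^ n‖ := by
  have h := norm_pow_sub_pow_sub_le hx hy hxδ hyδ n
  have h1 : ‖n • (x - y)‖ = n * ‖x - y‖ := by
    rw [← Nat.cast_smul_eq_nsmul ℝ n (x - y), norm_smul, Real.norm_eq_abs, Nat.abs_cast]
  have h2 : ‖n • (x - y)‖ - ‖x ^ n - y ^ n‖ ≤ ‖x ^ n - y ^ n - n • (x - y)‖ := by
    rw [← norm_neg (x ^ n - y ^ n - n • (x - y)), neg_sub]; exact norm_sub_norm_le _ _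
  nlinarith [h, h1, h2]

/-! ## §4 The far-pair defect against based fields -/

/-- ★★★ **Far slow pairs against based fields.**  `U = orthoTube u v`, `V = orthoTube u' v'` (balanced capped fibres), `‖q(u_k) − 1‖, ‖q(u'_k) − 1‖ ≤ δ`, and
`m := L(1 − (L−1)δ)·‖q(u_k) − q(u'_k)‖ − L√2(‖v̂‖ + ‖v̂'‖) ≥ 0`: for EVERY based field, `m²/L ≤ kinDefect U V (basedExt h)`. [cite: Luscher1983, §3] -/
theorem kinDefect_ge_based_far (u u' : GaugeConfig 3 1 SU2) {v v' : Edge 3 L → Fin 3 → ℝ} (hv : v ∈ capBalancedSet L) (hv' : v' ∈ capBalancedSet L)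
    (h : NzSite L → SU2) (k : Fin 3) {δ : ℝ} (hδ : ‖su2Quat (u (0, k)) - 1‖ ≤ δ) (hδ' : ‖su2Quat (u' (0, k)) - 1‖ ≤ δ)
    (hm : 0 ≤ L * (1 - (L - 1) * δ) * ‖su2Quat (u (0, k)) - su2Quat (u' (0, k))‖ - L * (Real.sqrt 2 * (‖linkEmbed L v‖ + ‖linkEmbed L v'‖))) :
    (L * (1 - (L - 1) * δ) * ‖su2Quat (u (0, k)) - su2Quat (u' (0, k))‖ - L * (Real.sqrt 2 * (‖linkEmbed L v‖ + ‖linkEmbed L v'‖))) ^ 2 / L ≤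
      kinDefect L (orthoTube L u v) (orthoTube L u' v') (basedExt L h) := by
  have hL : (0 : ℝ) < L := by exact_mod_cast Nat.pos_of_ne_zero (NeZero.ne L)
  set x := su2Quat (u (0, k))
  set y := su2Quat (u' (0, k))
  set PU := ((List.range L).map fun j : ℕ => su2Quat (orthoTube L u v ((j • Pi.single k (1 : ZMod L) : Site 3 L), k))).prod
  set PV := ((List.range L).map fun j : ℕ => su2Quat (orthoTube L u' v' ((j • Pi.single k (1 : ZMod L) : Site 3 L), k))).prod
  have hx : ‖x‖ = 1 := norm_su2Quat _
  have hy : ‖y‖ = 1 := norm_su2Quat _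
  -- the closed-line products are within `L√2‖v̂‖` of the slow powers, which separate linearly
  have hPU : ‖PU - x ^ L‖ ≤ L * (Real.sqrt 2 * ‖linkEmbed L v‖) := norm_lineProd_orthoTube_sub_pow_le (L := L) u hv k L
  have hPV : ‖PV - y ^ L‖ ≤ L * (Real.sqrt 2 * ‖linkEmbed L v'‖) := norm_lineProd_orthoTube_sub_pow_le (L := L) u' hv' k L
  have hpow := norm_pow_sub_pow_ge hx hy hδ hδ' L
  have htri : ‖x ^ L - y ^ L‖ ≤ ‖PU - PV‖ + ‖PU - x ^ L‖ + ‖PV - y ^ L‖ := by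
    have e : x ^ L - y ^ L = (PU - PV) - (PU - x ^ L) + (PV - y ^ L) := by abel
    rw [e]
    have h1 := norm_add_le ((PU - PV) - (PU - x ^ L)) (PV - y ^ L)
    have h2 := norm_sub_le (PU - PV) (PU - x ^ L)
    linarith
  have hlow : L * (1 - (L - 1) * δ) * ‖x - y‖ - L * (Real.sqrt 2 * (‖linkEmbed L v‖ + ‖linkEmbed L v'‖)) ≤ ‖PU - PV‖ := by nlinarith [hPU, hPV, hpow, htri]
  have hsq : ‖PU - PV‖ ^ 2 ≤ L * kinDefect L (orthoTube L u v) (orthoTube L u' v') (basedExt L h) :=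
    sq_norm_lineProd_sub_le_kinDefect (orthoTube L u v) (orthoTube L u' v') h k
  rw [div_le_iff₀ hL]
  calc (L * (1 - (L - 1) * δ) * ‖x - y‖ - L * (Real.sqrt 2 * (‖linkEmbed L v‖ + ‖linkEmbed L v'‖))) ^ 2
      ≤ ‖PU - PV‖ ^ 2 := pow_le_pow_left₀ hm hlow 2
    _ ≤ L * kinDefect L (orthoTube L u v) (orthoTube L u' v') (basedExt L h) := hsq
    _ = kinDefect L (orthoTube L u v) (orthoTube L u' v') (basedExt L h) * L := mul_comm _ _

end Summit.QuantumFields.YangMills.Theorems.FemtoTransferGap.TwoLattice.ConstTube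

end
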